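import Summits.KontsevichZagierPeriods.KontsevichZagierPeriods.Theorems.LinRedNormalFormHoffmanSpanInKZDerivedMerge
import Summits.KontsevichZagierPeriods.KontsevichZagierPeriods.Theorems.LinRedNormalFormHoffmanSpanInKZModBridge

/-!
# Crux `LinRedNormalForm.HoffmanSpanInKZ` (stmt-KontsevichZagierPeriods-15044), line `Sketch`:
# integer generators and the merge accumulator modulo a prime (registered stub `stub_modVec`)

Vocabulary for the EDS certificate tables of weight `≥ 11`, whose elimination transcripts are checked by the
kernel MODULO A PRIME `p` (all table entries `< p`) instead of over `ℚ` (where the late rows carry 60–280-digit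
rationals, beyond the farm's kernel limits):

* formal combinations with coefficients in any commutative ring `R` and their realisation `evalG R N`
  (for `R = ℚ` this is `FVec.eval`), with the coefficientwise description `evalG_apply` and the compatibility
  with ring homomorphisms `map_evalG`;
* the INTEGER expansion `Gen.fvecZ` of a generator of the relation family (finite double shuffle pair,
  Hoffman's relation, duality), mapping to the rational expansion `Gen.fvec` of
  `LinRedNormalFormHoffmanSpanInKZDerived` (`map_fvecZ_rat`), the integer vector `Gen.vecZ` and its two
  images `toQ (Gen.vecZ) = FVec.eval (Gen.fvec)` (`toQ_vecZ`) and `redP p (Gen.vecZ) = evalG (ZMod p) …`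
  (`redP_vecZ`);
* a Boolean support test `admOk` (every word of an expansion is admissible) with its meaning;
* the sorted-merge accumulator of `LinRedNormalFormHoffmanSpanInKZDerivedMerge` with coefficients in `ZMod p`
  (`insP`, `mergeP`, realisation lemmas).

Sources: the reflection set-up of `MzvKernelInKZTwoPosetsEdsCertificateLow` and the Derived files (this
tree). [folklore]
-/

namespace Summit.KontsevichZagierPeriods.LinRedNormalForm.HoffmanSpanInKZ

open Literature.NumberTheory.Transcendental
open Summit.KontsevichZagierPeriods.MzvKernelInKZ.Negative
open Summit.KontsevichZagierPeriods.MzvKernelInKZ.TwoPosets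

/-! ## Formal combinations over a ring and their realisation -/

section EvalG

variable (R : Type*) [CommRing R]

/-- Realisation of a formal combination of words with coefficients in `R` as a vector on the words of
length `N`. [folklore] -/
def evalG (N : ℕ) (v : List (List Bool × R)) : (Fin N → Bool) → R :=
  (v.map fun q => q.2 • (Pi.single (wordOf N q.1) (1 : R) : (Fin N → Bool) → R)).sum

variable {R}

/-- Realisation of the empty combination. [folklore] -/
@[simp] theorem evalG_nil (N : ℕ) : evalG R N [] = 0 := by simp [evalG]

/-- Realisation of a combination with a leading term. [folklore] -/
@[simp] theorem evalG_cons (N : ℕ) (q : List Bool × R) (v : List (List Bool × R)) :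
    evalG R N (q :: v) = q.2 • (Pi.single (wordOf N q.1) (1 : R) : (Fin N → Bool) → R) + evalG R N v := by
  simp [evalG]

/-- Realisation is additive under concatenation. [folklore] -/
@[simp] theorem evalG_append (N : ℕ) (u v : List (List Bool × R)) :
    evalG R N (u ++ v) = evalG R N u + evalG R N v := by
  simp [evalG, List.sum_append]

/-- The coefficient of a word in the realisation is the sum of the coefficients of its occurrences.
[folklore] -/
theorem evalG_apply (N : ℕ) (v : List (List Bool × R)) (ε : Fin N → Bool) :
    evalG R N v ε = (v.map fun q => if wordOf N q.1 = ε then q.2 else 0).sum := by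
  induction v with
  | nil => simp
  | cons q v ih =>
    rw [evalG_cons, Pi.add_apply, ih, List.map_cons, List.sum_cons, Pi.smul_apply, Pi.single_apply,
      smul_eq_mul, mul_ite, mul_one, mul_zero]
    simp only [eq_comm]

/-- Over `ℚ` the realisation is `FVec.eval`. [folklore] -/
theorem evalG_rat (N : ℕ) (v : FVec) : evalG ℚ N v = FVec.eval N v := rfl

/-- Realisation commutes with ring homomorphisms applied to the coefficients. [folklore] -/
theorem map_evalG {S : Type*} [CommRing S] (φ : R →+* S) (N : ℕ) (v : List (List Bool × R))
    (ε : Fin N → Bool) : φ (evalG R N v ε) = evalG S N (v.map fun q => (q.1, φ q.2)) ε := by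
  rw [evalG_apply, evalG_apply, map_list_sum, List.map_map, List.map_map]
  congr 1
  refine List.map_congr_left fun q _ => ?_
  simp only [Function.comp_apply, apply_ite φ, map_zero]

end EvalG

/-! ## Integer expansions of the generators -/

/-- Integer formal combinations of words. [folklore] -/
abbrev FVecZ : Type := List (List Bool × ℤ)

/-- A list of words with a common integer coefficient. [folklore] -/
def ofWordsZ (L : List (List Bool)) (c : ℤ) : FVecZ := L.map fun w => (w, c)

/-- The integer expansion of a generator (as `Gen.fvec`, with integer coefficients `±1`). [folklore] -/
def Gen.fvecZ (N : ℕ) : Gen → FVecZ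
  | .F s t => ofWordsZ (MZV.shuffleWord (MZV.binaryWord s) (MZV.binaryWord t)) 1 ++
      ofWordsZ ((MZV.stuffle s t).map MZV.binaryWord) (-1)
  | .D s => ((List.finRange s.length).map fun l =>
        (MZV.binaryWord (s.take l.1 ++ [s.get l + 1] ++ s.drop (l.1 + 1)), (1 : ℤ))) ++
      (List.finRange s.length).flatMap fun l => (List.range (s.get l - 1)).map fun j =>
        (MZV.binaryWord (s.take l.1 ++ [s.get l - j, j + 1] ++ s.drop (l.1 + 1)), (-1 : ℤ))
  | .K w => [(MZV.binaryWord w, 1), (List.ofFn (dualWord (wordOf N (MZV.binaryWord w))), -1)]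

/-- The rational expansion is the integer expansion with coefficients cast to `ℚ`. [folklore] -/
theorem map_fvecZ_rat (N : ℕ) : ∀ g : Gen,
    ((g.fvecZ N).map fun q => (q.1, (Int.castRingHom ℚ) q.2)) = g.fvec N
  | .F s t => by
    simp [Gen.fvecZ, Gen.fvec, fdsF, ofWordsZ, FVec.ofWords, List.map_map, Function.comp_def]
  | .D s => by
    simp [Gen.fvecZ, Gen.fvec, hoffmanF, List.map_append, List.map_map, List.map_flatMap,
      Function.comp_def]
  | .K w => by
    simp [Gen.fvecZ, Gen.fvec, dualF]

/-- The integer vector of a generator. [folklore] -/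
def Gen.vecZ (N : ℕ) (g : Gen) : (Fin N → Bool) → ℤ := evalG ℤ N (g.fvecZ N)

/-- Its rational image is the realisation of the rational expansion. [folklore] -/
theorem toQ_vecZ (N : ℕ) (g : Gen) : toQ (g.vecZ N) = FVec.eval N (g.fvec N) := by
  funext ε
  rw [toQ, ← map_fvecZ_rat, ← evalG_rat, ← map_evalG (Int.castRingHom ℚ) N (g.fvecZ N) ε]
  rfl

/-- The mod-`p` expansion of a generator. [folklore] -/
def Gen.fvecP (p N : ℕ) (g : Gen) : List (List Bool × ZMod p) :=
  (g.fvecZ N).map fun q => (q.1, (q.2 : ZMod p))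

/-- The reduction of the integer vector of a generator is the realisation of its mod-`p` expansion.
[folklore] -/
theorem redP_vecZ (p N : ℕ) (g : Gen) : redP p (g.vecZ N) = evalG (ZMod p) N (g.fvecP p N) := by
  funext ε
  show (Int.castRingHom (ZMod p)) (evalG ℤ N (g.fvecZ N) ε) = _
  rw [map_evalG (Int.castRingHom (ZMod p)) N (g.fvecZ N) ε]
  rfl

/-! ## Support on admissible words, decided -/

/-- Boolean test: every word of a formal combination reads back as an admissible word. [folklore] -/
def admOk {R : Type*} (N : ℕ) (v : List (List Bool × R)) : Bool :=
  v.all fun q => decide (Adm (wordOf N q.1))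

/-- A combination all of whose words are admissible realises to a vector vanishing off the admissible
words. [folklore] -/
theorem evalG_eq_zero_of_admOk {R : Type*} [CommRing R] (N : ℕ) (v : List (List Bool × R))
    (h : admOk N v = true) (ε : Fin N → Bool) (hε : ¬ Adm ε) : evalG R N v ε = 0 := by
  rw [evalG_apply]
  apply List.sum_eq_zero
  intro x hx
  obtain ⟨q, hq, rfl⟩ := List.mem_map.1 hx
  have hq' : Adm (wordOf N q.1) := of_decide_eq_true ((List.all_eq_true.1 h) q hq)
  rw [if_neg]
  rintro rfl
  exact hε hq'

/-! ## The merge accumulator modulo `p` -/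

section ModP

variable {p : ℕ}

/-- Scalar multiple of a mod-`p` combination. [folklore] -/
def smulP (c : ZMod p) (v : List (List Bool × ZMod p)) : List (List Bool × ZMod p) :=
  v.map fun q => (q.1, c * q.2)

/-- `smulP` scales the realisation. [folklore] -/
@[simp] theorem evalG_smulP (N : ℕ) (c : ZMod p) (v : List (List Bool × ZMod p)) :
    evalG (ZMod p) N (smulP c v) = c • evalG (ZMod p) N v := by
  induction v with
  | nil => simp [smulP]
  | cons q v ih =>
    simp only [smulP, List.map_cons, evalG_cons, smul_add, mul_smul] at ih ⊢
    rw [ih]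

/-- Insert-add one term into an association list sorted by `ltW` (mod `p`). [folklore] -/
def insP (w : List Bool) (c : ZMod p) : List (List Bool × ZMod p) → List (List Bool × ZMod p)
  | [] => [(w, c)]
  | (w', c') :: l =>
    if w = w' then (if c + c' = 0 then l else (w', c + c') :: l)
    else if ltW w w' then (w, c) :: (w', c') :: l
    else (w', c') :: insP w c l

/-- Inner recursion of `mergeP` (as `mergeWAux`). [folklore] -/
def mergePAux (q : List Bool × ZMod p)
    (contV : List (List Bool × ZMod p) → List (List Bool × ZMod p)) :
    List (List Bool × ZMod p) → List (List Bool × ZMod p)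
  | [] => q :: contV []
  | (w', x') :: acc =>
    if q.1 = w' then (if q.2 + x' = 0 then contV acc else (w', q.2 + x') :: contV acc)
    else if ltW q.1 w' then q :: contV ((w', x') :: acc)
    else (w', x') :: mergePAux q contV acc

/-- Merge `c • v` into `acc` (both sorted by `ltW`; mod `p`). [folklore] -/
def mergeP (c : ZMod p) : List (List Bool × ZMod p) → List (List Bool × ZMod p) → List (List Bool × ZMod p)
  | [] => fun acc => acc
  | (w, x) :: v => mergePAux (w, c * x) (mergeP c v)

/-- `insP` adds one term to the realisation. [folklore] -/
theorem evalG_insP {N : ℕ} (w : List Bool) (c : ZMod p) : ∀ l,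
    evalG (ZMod p) N (insP w c l) =
      c • (Pi.single (wordOf N w) (1 : ZMod p) : (Fin N → Bool) → ZMod p) + evalG (ZMod p) N l
  | [] => by simp [insP]
  | (w', c') :: l => by
    unfold insP
    split_ifs with h1 h2 h3
    · subst h1
      rw [evalG_cons, ← add_assoc, ← add_smul, h2, zero_smul, zero_add]
    · subst h1
      rw [evalG_cons, evalG_cons, add_smul, add_assoc]
    · rw [evalG_cons]
    · rw [evalG_cons, evalG_cons, evalG_insP w c l]
      abel

/-- `mergePAux` realises to the term plus the continuation's contribution. [folklore] -/
theorem evalG_mergePAux {N : ℕ} (q : List Bool × ZMod p)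
    (contV : List (List Bool × ZMod p) → List (List Bool × ZMod p)) (e : (Fin N → Bool) → ZMod p)
    (hcont : ∀ acc, evalG (ZMod p) N (contV acc) = e + evalG (ZMod p) N acc) :
    ∀ acc, evalG (ZMod p) N (mergePAux q contV acc) =
      q.2 • (Pi.single (wordOf N q.1) (1 : ZMod p) : (Fin N → Bool) → ZMod p) + e +
        evalG (ZMod p) N acc
  | [] => by simp only [mergePAux, evalG_cons, hcont, evalG_nil]; abel
  | (w', x') :: acc => by
    unfold mergePAux
    split_ifs with h1 h2 h3
    · rw [hcont, evalG_cons, ← h1]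
      have : q.2 • (Pi.single (wordOf N q.1) (1 : ZMod p) : (Fin N → Bool) → ZMod p) +
          x' • (Pi.single (wordOf N q.1) (1 : ZMod p) : (Fin N → Bool) → ZMod p) = 0 := by
        rw [← add_smul, h2, zero_smul]
      rw [show q.2 • (Pi.single (wordOf N q.1) (1 : ZMod p) : (Fin N → Bool) → ZMod p) + e +
          (x' • (Pi.single (wordOf N q.1) (1 : ZMod p) : (Fin N → Bool) → ZMod p) +
            evalG (ZMod p) N acc) =
          (q.2 • (Pi.single (wordOf N q.1) (1 : ZMod p) : (Fin N → Bool) → ZMod p) +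
            x' • (Pi.single (wordOf N q.1) (1 : ZMod p) : (Fin N → Bool) → ZMod p)) +
            (e + evalG (ZMod p) N acc) by abel,
        this, zero_add]
    · rw [evalG_cons, hcont, evalG_cons, ← h1, add_smul]
      abel
    · rw [evalG_cons, hcont, evalG_cons]
      abel
    · rw [evalG_cons, evalG_cons, evalG_mergePAux q contV e hcont acc]
      abel

/-- `mergeP c v acc` realises to `c • v + acc`. [folklore] -/
theorem evalG_mergeP {N : ℕ} (c : ZMod p) : ∀ v acc,
    evalG (ZMod p) N (mergeP c v acc) = c • evalG (ZMod p) N v + evalG (ZMod p) N acc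
  | [], acc => by simp [mergeP]
  | (w, x) :: v, acc => by
    rw [mergeP, evalG_mergePAux (w, c * x) (mergeP c v) (c • evalG (ZMod p) N v) (evalG_mergeP c v) acc,
      evalG_cons, smul_add, mul_smul]

/-- Folding `insP` over a list of terms adds their realisation. [folklore] -/
theorem evalG_foldl_insP {N : ℕ} : ∀ (g acc : List (List Bool × ZMod p)),
    evalG (ZMod p) N (g.foldl (fun a q => insP q.1 q.2 a) acc) = evalG (ZMod p) N g + evalG (ZMod p) N acc
  | [], acc => by simp
  | q :: g, acc => by
    rw [List.foldl_cons, evalG_foldl_insP g, evalG_insP, evalG_cons]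
    abel

/-- Folding `mergeP` over citations adds the cited combination. [folklore] -/
theorem evalG_foldl_mergeP {N : ℕ} (mem : List (List (List Bool × ZMod p))) (f : ℕ → ZMod p) :
    ∀ (L : List (ℕ × ℕ)) (acc : List (List Bool × ZMod p)),
      evalG (ZMod p) N (L.foldl (fun a q => mergeP (f q.2) (mem.getD q.1 []) a) acc) =
        (L.map fun q => f q.2 • evalG (ZMod p) N (mem.getD q.1 [])).sum + evalG (ZMod p) N acc
  | [], acc => by simp
  | q :: L, acc => by
    rw [List.foldl_cons, evalG_foldl_mergeP mem f L, evalG_mergeP, List.map_cons, List.sum_cons]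
    abel

end ModP

/-! ## The registered stub -/

/-- The facts of this file used downstream, as one statement (vocabulary file; not a published fact). -/
def ModVecSound : Prop :=
  (∀ (N : ℕ) (g : Gen), toQ (g.vecZ N) = FVec.eval N (g.fvec N)) ∧
  (∀ (p N : ℕ) (g : Gen), redP p (g.vecZ N) = evalG (ZMod p) N (g.fvecP p N))

/-- **Registered stub `stub_modVec`** of the skeleton of line `Sketch`. -/
theorem stub_modVec : ModVecSound := ⟨toQ_vecZ, redP_vecZ⟩

end Summit.KontsevichZagierPeriods.LinRedNormalForm.HoffmanSpanInKZ
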